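import Literature.NumberTheory.DiophantineGeometry.GeneralizedFermatTwoPowerCoefficientMazurPrimeLeavesProofs
import Literature.NumberTheory.EllipticCurves.KubertFourteenProofs
import HarnessLib

/-!
# Ribet 1997, Theorem 3: the Mazur input reduced to Mazur–Tate's `13`-torsion theorem and Mazur's
# Step 3 (proofs)

Topic `Literature/NumberTheory/DiophantineGeometry`; a further sibling *proofs* file (theorems
only: no definition, no named fact, no `sorry`) of `GeneralizedFermatTwoPowerCoefficient` (named
fact `ribet1997_twoPowerFermat`: K. Ribet, *On the equation `aᵖ + 2^α bᵖ + cᵖ = 0`*, Acta Arith.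
79 (1997) 7–16, Thm. 3).  One-term compositions of `…MazurPrimeLeavesProofs` (Theorem 3 from the
three torsion inputs `h14`, `h13`, `hE`) with `KubertFourteenProofs.not_exists_addOrderOf_eq_fourteen`
(no rational point of order `14`: `X₁(14)(ℚ)` is cuspidal, Kubert 1976 Ch. IV — a THEOREM of the
tree: `KubertTateFourteen`, `X1FourteenMordellWeil`), which discharges `h14`.

So, of Mazur's theorem `[14]`, Ribet's Theorem 3 now rests on exactly two named facts:
`MazurTate1973_no_torsion_thirteen` (no rational point of order `13`) and
`Mazur1977_stepThree_eisenstein` (Mazur 1977, Ch. III §5, Step 3: the Eisenstein quotient, for the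
primes `N ≥ 17`); the other inputs being Serre's conjecture `khare_wintenberger` (Serre's road), or
Ribet's own Theorem 5 `exists_isNewformOf` with the level-lowering hypothesis `hLL` ("[18]",
Diamond 1995 Thm. 1.1) (the printed road).

## Main statements

* `EllipticCurves.noTwoTorsionPrime_seven` — `(⋆₇)` unconditionally; `noTwoTorsionPrime_of_mazurTate_of_stepThree`,
  `hasIrreducibleModPGaloisRep_of_isSemistable_of_rational_two_torsion_of_mazurTate_of_stepThree`.
* `ribet1997_twoPowerFermat_of_khare_wintenberger_of_mazurTate_of_stepThree`.
* `ribet1997_twoPowerFermat_of_modularity_of_levelLowering_of_mazurTate_of_stepThree`.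
* `hasIrreducibleModPGaloisRep_freyCurve_of_mazurTate_of_stepThree` — Prop. 1 for the Frey curves.

## References

* [Ribet1997] K. A. Ribet, Acta Arith. 79 (1997) 7–16: Thm. 3, Thm. 5, Prop. 1, §3.
* [Mazur1977] B. Mazur, Publ. Math. IHÉS 47 (1977): Ch. III §5, Step 3 (p. 159).
* [MazurTate1973] B. Mazur, J. Tate, Invent. Math. 22 (1973) 41–49.
* [Kubert1976] D. S. Kubert, Proc. London Math. Soc. (3) 33 (1976), Ch. IV (`X₁(14)`).
* [KhareWintenberger2009] Thm. 1.2; [Diamond1995RefinedSerre] Thm. 1.1; [BCDTJAMS2001] Theorem A.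
-/

noncomputable section

open scoped MatrixGroups ModularForm NumberField
open CongruenceSubgroup UpperHalfPlane Polynomial

namespace Literature.NumberTheory.EllipticCurves

open _root_.WeierstrassCurve

/-! ## Part A. `(⋆₇)` unconditionally, and `(⋆ₚ)` for all `p ≥ 5` from the two leaves -/

/-- **`(⋆₇)`, unconditionally**: no elliptic curve over `ℚ` has rational points `P₁ ≠ P₂` of order
`2` and `Q` of order `7` (`P₂ + Q` would have order `14`, excluded by
`not_exists_addOrderOf_eq_fourteen`). [cite: Ribet1997, Prop. 1 (p. 11–12)] [cite: Kubert1976, Ch. IV (X₁(14))] -/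
theorem noTwoTorsionPrime_seven (V : WeierstrassCurve ℚ) [V.IsElliptic]
    {P₁ P₂ Q : V.toAffine.Point} (hP₁ : addOrderOf P₁ = 2) (hP₂ : addOrderOf P₂ = 2)
    (h12 : P₁ ≠ P₂) (hQ : addOrderOf Q = 7) : False :=
  noTwoTorsionPrime_seven_of (fun V _ => not_exists_addOrderOf_eq_fourteen V) V hP₁ hP₂ h12 hQ

/-- **`(⋆ₚ)` for every prime `p ≥ 5` from Mazur–Tate's `13` and Mazur's Step 3 alone** (the primes
`5, 7, 11` being theorems of the tree: Kubert's `X₁(2,10)`, `X₁(14)`, Billing–Mahler).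
[cite: Ribet1997, Prop. 1 (p. 11–12)] [cite: Mazur1977, Thm 8 and Ch. III §5 p. 156] -/
theorem noTwoTorsionPrime_of_mazurTate_of_stepThree
    (h13 : ∀ V : WeierstrassCurve ℚ, MazurTate1973_no_torsion_thirteen V)
    (hE : Mazur1977_stepThree_eisenstein) {p : ℕ} (hp : p.Prime) (h5 : 5 ≤ p)
    (V : WeierstrassCurve ℚ) [V.IsElliptic]
    {P₁ P₂ Q : V.toAffine.Point} (hP₁ : addOrderOf P₁ = 2) (hP₂ : addOrderOf P₂ = 2)
    (h12 : P₁ ≠ P₂) (hQ : addOrderOf Q = p) : False :=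
  noTwoTorsionPrime_of_leaves (fun V _ => not_exists_addOrderOf_eq_fourteen V) h13 hE hp h5 V
    hP₁ hP₂ h12 hQ

/-- **Ribet 1997, Prop. 1 (semistable case), all primes `p ≥ 5`, from Mazur–Tate's `13`-torsion
theorem and Mazur's Step 3 alone** (`hasIrreducibleModPGaloisRep_of_isSemistable_of_rational_two_torsion_of_leaves`
with `h14` discharged by `not_exists_addOrderOf_eq_fourteen`).
[cite: Ribet1997, Prop. 1 (p. 11–12)] [cite: Serre1987, §4.1 Prop. 6] [cite: Mazur1977, Thm 8] -/
theorem hasIrreducibleModPGaloisRep_of_isSemistable_of_rational_two_torsion_of_mazurTate_of_stepThree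
    (h13 : ∀ V : WeierstrassCurve ℚ, MazurTate1973_no_torsion_thirteen V)
    (hE : Mazur1977_stepThree_eisenstein)
    (W : WeierstrassCurve ℚ) [W.IsElliptic] (hW : W.IsSemistable ℤ)
    (h2 : ∀ (σ : Field.absoluteGaloisGroup ℚ) (P : W.geomPoints), 2 • P = 0 → σ • P = P)
    {p : ℕ} (hp : p.Prime) (h5 : 5 ≤ p) : W.HasIrreducibleModPGaloisRep p :=
  hasIrreducibleModPGaloisRep_of_isSemistable_of_rational_two_torsion_of_leaves
    (fun V _ => not_exists_addOrderOf_eq_fourteen V) h13 hE W hW h2 hp h5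

end Literature.NumberTheory.EllipticCurves

/-! ## Part B. Theorem 3 -/

namespace Literature.NumberTheory.DiophantineGeometry

open WeierstrassCurve GaloisRepresentations EllipticCurves EllipticCurves.ModularForms
  Rat.HeightOneSpectrum IsDedekindDomain IsDedekindDomain.HeightOneSpectrum
  Literature.NumberTheory.Automorphic Literature.NumberTheory.Automorphic.BCDT

open ValuativeRel GaloisRepresentations.ModPGaloisRep GaloisRepresentations.IsNonarchimedeanLocalField

/-- **Ribet 1997, Proposition 1 for the normalised Frey curves, all `p ≥ 5`, from Mazur–Tate's
`13`-torsion theorem and Mazur's Step 3** (`h14` of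
`hasIrreducibleModPGaloisRep_freyCurve_of_mazur_prime_leaves` discharged by
`not_exists_addOrderOf_eq_fourteen`). [cite: Ribet1997, Prop. 1 and Corollary (p. 11–12)] [cite: Mazur1977, Thm 8 and Ch. III §5] -/
theorem hasIrreducibleModPGaloisRep_freyCurve_of_mazurTate_of_stepThree {A B : ℤ}
    (h13 : ∀ V : WeierstrassCurve ℚ, MazurTate1973_no_torsion_thirteen V)
    (hE : Mazur1977_stepThree_eisenstein)
    (hAB : IsCoprime A B) (h0 : A * B * (A + B) ≠ 0) (hA : A ≡ -1 [ZMOD 4]) (h4 : (4 : ℤ) ∣ B)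
    {p : ℕ} (hp : p.Prime) (h5 : 5 ≤ p) : (freyCurve A B).HasIrreducibleModPGaloisRep p :=
  hasIrreducibleModPGaloisRep_freyCurve_of_mazur_prime_leaves
    (fun V _ => not_exists_addOrderOf_eq_fourteen V) h13 hE hAB h0 hA h4 hp h5

/-- **Ribet 1997, Theorem 3, from `khare_wintenberger`, `MazurTate1973_no_torsion_thirteen` and
`Mazur1977_stepThree_eisenstein`** — for a prime `p ≥ 5` and `2 ≤ α < p`, `xᵖ + 2^α yᵖ + zᵖ = 0`
has no solution in pairwise coprime non-zero integers; granted Serre's conjecture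
(Khare–Wintenberger 2009, Thm. 1.2) and, of Mazur's torsion theorem, only the `13`-torsion theorem
of Mazur–Tate and the Eisenstein-quotient Step 3 for the primes `≥ 17`; every other input of
Ribet's §§2–3 — including Kubert's `X₁(2,10)`, `X₁(14)` (this tree: `KubertTateFourteen`,
`X1FourteenMordellWeil`) and Billing–Mahler's `X₁(11)` — is a theorem of the tree.
[cite: Ribet1997, Thm. 3, Prop. 1, §§2–3] [cite: KhareWintenberger2009, Thm. 1.2]
[cite: Mazur1977, Ch. III §5, Step 3 (p. 159)] [cite: MazurTate1973, main theorem] -/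
theorem ribet1997_twoPowerFermat_of_khare_wintenberger_of_mazurTate_of_stepThree
    (hKW : ∀ (p : ℕ) [Fact p.Prime] (k : Type) [Field k] [TopologicalSpace k] [DiscreteTopology k],
      khare_wintenberger p k)
    (h13 : ∀ V : WeierstrassCurve ℚ, MazurTate1973_no_torsion_thirteen V)
    (hE : Mazur1977_stepThree_eisenstein) : ribet1997_twoPowerFermat :=
  ribet1997_twoPowerFermat_of_khare_wintenberger_of_mazur_prime_leaves hKW
    (fun V _ => not_exists_addOrderOf_eq_fourteen V) h13 hE

/-- **Ribet 1997, Theorem 3 along the PRINTED road, from Theorem 5 (`exists_isNewformOf`),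
level-lowering "[18]" (Diamond 1995 Thm. 1.1, hypothesis `hLL`), `MazurTate1973_no_torsion_thirteen`
and `Mazur1977_stepThree_eisenstein`** — the finest statement of what Theorem 3 rests on in the tree
along Ribet's own road (`h14` of `…_of_mazur_prime_leaves` discharged by
`not_exists_addOrderOf_eq_fourteen`). [cite: Ribet1997, Thm. 3, Thm. 5, Prop. 1, §3 p. 13] [cite: Ribet1990, Thm. 1.1]
[cite: Diamond1995RefinedSerre, Thm. 1.1] [cite: BCDTJAMS2001, Theorem A]
[cite: Mazur1977, Ch. III §5, Step 3 (p. 159)] [cite: MazurTate1973, main theorem] -/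
theorem ribet1997_twoPowerFermat_of_modularity_of_levelLowering_of_mazurTate_of_stepThree
    (hmod : exists_isNewformOf)
    (hLL : ∀ (ℓ : ℕ) [Fact ℓ.Prime], Odd ℓ →
      ∀ (k : Type) [Field k] [TopologicalSpace k] [DiscreteTopology k] [CharP k ℓ] [IsAlgClosed k]
        (ρ : ModPGaloisRep ℚ k 2), ρ.toGaloisRep.IsIrreducible → FramedGaloisRep.IsOdd ρ →
        ρ.IsModular →
        ∀ (loc : LocalRestrictionAt ℓ ρ)
          (ι : absIntegers 𝒪[loc.F] loc.F ⧸ absMaximalIdeal loc.F →+* k),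
          ∃ (M : ℕ) (_ : NeZero M), M ∣ serreLevel ℓ ρ ∧
            ∃ (f : CuspForm (Gamma1 M) (serreWeight ℓ ρ loc ι : ℤ))
              (ιf : coeffCharIntegers f →+* k),
              IsNewform1 f ∧ IsGaloisRepOfNewform1Int f ιf {q | q ∣ M * ℓ} ρ)
    (h13 : ∀ V : WeierstrassCurve ℚ, MazurTate1973_no_torsion_thirteen V)
    (hE : Mazur1977_stepThree_eisenstein) : ribet1997_twoPowerFermat :=
  ribet1997_twoPowerFermat_of_modularity_of_levelLowering_of_mazur_prime_leaves hmod hLL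
    (fun V _ => not_exists_addOrderOf_eq_fourteen V) h13 hE

/-- **Serre's road through the printed assembly**, granted Theorem 5: `hLL` from
`levelLowering_of_khare_wintenberger` — a consistency check. [cite: Ribet1997, Thm. 3] -/
theorem ribet1997_twoPowerFermat_of_modularity_of_khare_wintenberger_of_mazurTate_of_stepThree
    (hmod : exists_isNewformOf)
    (hKW : ∀ (p : ℕ) [Fact p.Prime] (k : Type) [Field k] [TopologicalSpace k] [DiscreteTopology k],
      khare_wintenberger p k)
    (h13 : ∀ V : WeierstrassCurve ℚ, MazurTate1973_no_torsion_thirteen V)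
    (hE : Mazur1977_stepThree_eisenstein) : ribet1997_twoPowerFermat :=
  ribet1997_twoPowerFermat_of_modularity_of_levelLowering_of_mazurTate_of_stepThree hmod
    (levelLowering_of_khare_wintenberger hKW) h13 hE

end Literature.NumberTheory.DiophantineGeometry

end
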